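/-
Copyright (c) 2026 the pub-hodgecm-mathlib formalisation cell (harness21).  Prover seat hodgecm-mathlib-LH3-p04 (g3): LH3 «Transf» road,
organ (M2) `hcont` ∕ (I₁)-half of (SB-TRANSF) (dealer LH3-plan (g3) board #1 (i) 2026-09-02), pieces (0)+(2) of the census 2026-09-02T07:11Z.
-/
import Literature.NumberTheory.Rogawski1990.ArchTransfFamilyMirrorPairing      -- ★ p850077 F0P3a-p09 (g5) (GLUE-X-dress) A1: `transfFamReg_eq_prefactor_mul_sum` (no division left)
import Literature.NumberTheory.Rogawski1990.ArchTransfFamilyPrefactorSmooth     -- ★ p850086 F0P3a-p09 (g5) A2: `contDiff_coe_coord`, `contDiff_coe_circleExp_coord∕_mul_zpow`, `contDiff_cexp_comp`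
import Literature.NumberTheory.Rogawski1990.ArchTransfFamilySymmetries          -- ★ p849794 LH7-p02 (g2): `dense_regG`
import Literature.NumberTheory.Rogawski1990.ArchHCSpaceG                       -- ★ p849664∕p849799 LH3-p02 (g2) D2′: `ArchHcSmoothOneSided` ((I₁) of `F`), brings ★ (COORD) `InRegG`, `IsIndefiniteAt`
import HarnessLib

/-!
# The partner sum `transfFamReg` RESOLVED: its prefactor is an entire unit monomial; `transfFam` is `C^∞` near every tame point of `InRegS S`
# (Rogawski 1990 §4.3 (4.3.1) p. 43, §4.9 p. 55; Shelstad 1979 §4 pp. 22–24; Bouaziz 1994 §3.2 p. 579, Rem. 2 p. 594)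

Topic `NumberTheory/Rogawski1990`; namespace `Literature.NumberTheory.Rogawski1990`.  THEOREMS ONLY (no `def`, no instance, no notation, no axiom, no named fact,
no `sorry`); kernel lane `--supports stmt-HodgeConjecture-24833`.  Cell `pub/hodgecm-mathlib`, crux H413 (`stmt-HodgeConjecture-24833`), F0∕P3c line LH3 (closer stub
`stub_N9`, DIRECT ROAD «Transf», organ O-L2 `stub_N9transf`); pieces (0) «`RegG` points ∕ resolved prefactor» and (2) «real walls» of LH3-p04 (g3)'s cut of (M2) = the
(I₁)-half of (SB-TRANSF) (dealer LH3-plan (g3) board #1 (i), census 2026-09-02T07:11Z; F0P3a-p09 (g5) 07:14:41Z «(0) not in A2, (2)(3) yours»).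

THE MATHEMATICS.  ★ A1 (p850077) rewrote the `Δ″`-weighted partner sum on the `G`-regular set as
`transfFamReg S c = (archRH S c · w_S · M♭_k(c)) · Σ_{ρ ∈ partnerPerms S} (K_ρσ_ρ) · (archERhoG S (ρ·c) · F S (ρ·c))` with the prefactor `M♭_k` (divisions by
`E₀ − E₂` at the compact places and by `R′_w = |eˣ−e⁻ˣ|·|e^{x+iθ}−e^{iφ}|·|e^{−x+iθ}−e^{iφ}|` at the split ones), smooth on the `H`-regular set `RegS S` (★ A2).  §1–§2
here RESOLVE that prefactor: **on `RegS S`, `archRH S c · M♭_k(c) = Ũ_k(c) := Π_{w ∈ S} e^{i(2k_w+1)c_{w2}} · Π_{w ∉ S} (E_{w0}E_{w2})^{k_w} E_{w2}`** — an ENTIRE UNIT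
MONOMIAL in the unit eigenvalues, defined and `C^∞` on the whole coordinate space, across the real walls `x_w = 0` and the `H`-walls alike.  At a compact place this is
the one-line `(1 − E₂∕E₀)·(E₀E₂)^kE₀E₂∕(E₀−E₂) = (E₀E₂)^kE₂`; at a split place it is the identity `|eˣ−e⁻ˣ|·(τD)_w = e^{i(2k+1)θ}·R′_w` (`x ≠ 0`), which rests on
`(E₁−E₀)(E₁−E₂) = −E₁E₂·|E₁−E₀|²` and `|E₂−E₁| = e^{−x}|E₁−E₀|` for the boost triple `E = (e^{x+iθ}, e^{iφ}, e^{−x+iθ})` (`E₂ = 1∕Ē₀`, `|E₁| = 1`) — so the moduli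
of the two complex roots in `R′_w` are EATEN by `D_{G∕H}`'s factor `q_w = (E₁−E₀)(E₁−E₂)`, including on the `H`-central locus `e^{iφ} = e^{iθ}` where both vanish.  Hence
(§3) **`transfFamReg S c = w_S·Ũ_k(c)·Σ_ρ (K_ρσ_ρ)·archERhoG S(ρ·c)·F S(ρ·c)` on `RegG S`**, whose right side `Φ_k` is `C^∞` wherever every partner point `ρ·c` lies in
Bouaziz's `T_{in-reg}` of `G′` (★ `InRegG (slotSign L α) S`, where HC's (I₁) clause ★ `ArchHcSmoothOneSided` makes `F S` smooth): the open set
`V_S = {c | ∀ ρ ∈ partnerPerms S, slotPerm ρ c ∈ InRegG (slotSign L α) S}`.  §4: **at every point `p ∈ InRegS S ∩ V_S` the family member `transfFam … S` (★ `bzExtendG`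
of `transfFamReg`) is `C^∞` on a neighbourhood** — it IS `Φ_k` there (`RegG S` is dense, ★ `dense_regG`; `extendFrom` agrees with the continuous `Φ_k`).  The TAME points
`InRegS S ∩ V_S` are exactly the points that are `G`-regular at every INDEFINITE compact place: all of `RegG S`, every REAL-WALL point `x_w = 0` (`w ∈ S`, any number of
them at once, the `H`-central locus included — HC: the split Cartan carries no jump, Varadarajan 1977 I §1.12; ★ `InRegG` has no condition at split places), and every
`G`-wall point at a DEFINITE place (compact walls only).  What is NOT tame — the `H`-regular `G`-walls at an indefinite compact place (noncompact for 4 of the 6 partner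
slots: the κ-pair cancellation, F0P3a-p09 (g5)'s FILE B) and the corners they form with the other walls (★ p850123 `contDiffOn_extendFrom_of_arrangement`) — is the
assembly file `ArchTransfFamilySmoothInRegS.lean`; the (I₁)-shape jet bounds of `Φ_k` on `K ∩ RegG S` are its sibling `ArchTransfFamilyJetBounds.lean`.

HONEST LABEL: HC_CM is proved only modulo the 7 printed citations (2 remaining: hLiu418 = `stmt-HodgeConjecture-24832`, h413 = `stmt-HodgeConjecture-24833`) until rung 0
closes; count-neutral calculus under O-L2, pays no organ by itself.

## References
* [Rogawski1990] J. D. Rogawski, *Automorphic Representations of Unitary Groups in Three Variables*, Ann. of Math. Stud. 123 (1990), §4.3 (4.3.1) p. 43, §4.9 p. 55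
  (`Δ = τ·D_{G∕H}·κ`), §8.2 p. 119 (`τ(γ)|A₁A₂|` explicit), §3.6 p. 31 (the Cartan subgroups; the boost `e^{±x+iθ}`).
* [Shelstad1979] D. Shelstad, *Characters and inner forms of a quasi-split group over ℝ*, Compositio Math. 39 (1979), §4 pp. 22–24 (`R_T`, `T_reg`, (II)).
* [Bouaziz1994IntegralesOrbitales] A. Bouaziz, *Intégrales orbitales sur les groupes de Lie réductifs*, Ann. Sci. ÉNS 27 (1994), §3.2 (I₁)–(I₂) p. 579, Rem. 2 p. 594.
* [Varadarajan1977] V. S. Varadarajan, *Harmonic Analysis on Real Reductive Groups*, LNM 576 (1977), Part I §1.12 (`'F_f` smooth across the real roots).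
-/

set_option autoImplicit false

noncomputable section

open NumberField NumberField.InfinitePlace Complex Equiv Finset Filter Topology Set
open scoped MatrixGroups ComplexConjugate Classical ContDiff
open Literature.NumberTheory.Automorphic Literature.NumberTheory.Automorphic.UnitaryGroup Literature.NumberTheory.Automorphic.ArchCartan
open Literature.NumberTheory.GaloisRepresentations

namespace Literature.NumberTheory.Rogawski1990

/-! ## §1 Per-place algebra: the prefactor resolved at a compact place and at a split place -/

section PlaceAlgebra

/-- **Compact place**: `(1 − E₂∕E₀) · ((E₀E₂)^k·E₀E₂ ∕ (E₀ − E₂)) = (E₀E₂)^k·E₂` for `E₀ ≠ 0`, `E₀ ≠ E₂` — the `H`-normaliser `R_H = 1 − e^{i(θ₂−θ₀)}` times ★ A1's compact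
prefactor is a unit monomial. [cite: Shelstad1979, §4 p. 22] [cite: Rogawski1990, §4.9 p. 55] -/
theorem compactPrefactor_resolve {E0 E2 : ℂ} (h0 : E0 ≠ 0) (h02 : E0 ≠ E2) (k : ℤ) :
    (1 - E2 / E0) * ((E0 * E2) ^ k * (E0 * E2) / (E0 - E2)) = (E0 * E2) ^ k * E2 := by
  have h : E0 - E2 ≠ 0 := sub_ne_zero.2 h02
  field_simp

/-- **The boost triple's root identity**: for `r > 0` and unit `u, v`, `(v − r·u)(v − r⁻¹·u) = −r⁻¹·u·v · (r·u − v)·conj(r·u − v)` — `D_{G∕H}`'s factor `q = (E₁−E₀)(E₁−E₂)` at a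
split place is `−E₁E₂·|E₁−E₀|²` (`E₀ = r·u`, `E₂ = r⁻¹·u = 1∕Ē₀`, `E₁ = v`). [cite: Rogawski1990, §3.6 p. 31; §4.9 p. 55] -/
theorem boost_root_product_eq {r : ℝ} (hr : 0 < r) {u v : ℂ} (hu : ‖u‖ = 1) (hv : ‖v‖ = 1) :
    (v - r * u) * (v - (r : ℂ)⁻¹ * u) = -((r : ℂ)⁻¹ * u * v) * ((r * u - v) * conj (r * u - v)) := by
  have hu0 : u ≠ 0 := fun h => by simp [h] at hu
  have hv0 : v ≠ 0 := fun h => by simp [h] at hv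
  have hr0 : (r : ℂ) ≠ 0 := Complex.ofReal_ne_zero.2 hr.ne'
  have hcu : conj u = u⁻¹ := (Complex.inv_eq_conj hu).symm
  have hcv : conj v = v⁻¹ := (Complex.inv_eq_conj hv).symm
  rw [map_sub, map_mul, Complex.conj_ofReal, hcu, hcv]
  field_simp
  ring

/-- **The two complex roots at a split place have proportional moduli**: `‖r⁻¹·u − v‖ = r⁻¹·‖r·u − v‖` for unit `u, v` (`E₂ − E₁ = E₁E₂·conj(E₁ − E₀)` up to sign).
[cite: Rogawski1990, §3.6 p. 31] [cite: Shelstad1979, §4 p. 22] -/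
theorem norm_boost_root_two {r : ℝ} (hr : 0 < r) {u v : ℂ} (hu : ‖u‖ = 1) (hv : ‖v‖ = 1) :
    ‖(r : ℂ)⁻¹ * u - v‖ = r⁻¹ * ‖(r : ℂ) * u - v‖ := by
  have hu0 : u ≠ 0 := fun h => by simp [h] at hu
  have hv0 : v ≠ 0 := fun h => by simp [h] at hv
  have hr0 : (r : ℂ) ≠ 0 := Complex.ofReal_ne_zero.2 hr.ne'
  have hcu : conj u = u⁻¹ := (Complex.inv_eq_conj hu).symm
  have hcv : conj v = v⁻¹ := (Complex.inv_eq_conj hv).symm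
  -- `r⁻¹u − v = −u·v·r⁻¹·conj(r·u − v)`
  have key : (r : ℂ)⁻¹ * u - v = -(u * v * (r : ℂ)⁻¹) * conj (r * u - v) := by
    rw [map_sub, map_mul, Complex.conj_ofReal, hcu, hcv]
    field_simp
    ring
  rw [key, norm_mul, norm_neg, norm_mul, norm_mul, hu, hv, one_mul, one_mul, Complex.norm_conj, norm_inv, Complex.norm_real,
    Real.norm_eq_abs, abs_of_pos hr]

/-- **Split place**: `|r − r⁻¹| · [−((E₀E₂)^k(E₁−E₀)(E₁−E₂)∕E₁) ∕ (|r − r⁻¹|·‖E₀−E₁‖·‖E₂−E₁‖)] = u^{2k+1}` for the boost triple `E₀ = r·u`, `E₁ = v`, `E₂ = r⁻¹·u` (`r > 0`, `r ≠ 1`,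
`u, v` unit) — the `H`-normaliser `R_H = |eˣ − e⁻ˣ|` times ★ A1's split prefactor `(τD)_w ∕ R′_w` is the unit monomial `e^{i(2k+1)θ}`: the real root cancels and the moduli of the two
complex roots in `R′_w` are eaten by `(E₁−E₀)(E₁−E₂) = −E₁E₂|E₁−E₀|²`. [cite: Rogawski1990, §4.9 p. 55; §8.2 p. 119] [cite: Shelstad1979, §4 p. 22] -/
theorem splitPrefactor_resolve {r : ℝ} (hr : 0 < r) (hr1 : r ≠ 1) {u v : ℂ} (hu : ‖u‖ = 1) (hv : ‖v‖ = 1) (k : ℤ) :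
    ((|r - r⁻¹| : ℝ) : ℂ) *
        (-((((r : ℂ) * u * ((r : ℂ)⁻¹ * u)) ^ k * ((v - r * u) * (v - (r : ℂ)⁻¹ * u))) / v) /
          ((|r - r⁻¹| * ‖(r : ℂ) * u - v‖ * ‖(r : ℂ)⁻¹ * u - v‖ : ℝ) : ℂ)) = u ^ (2 * k + 1) := by
  have hu0 : u ≠ 0 := fun h => by simp [h] at hu
  have hv0 : v ≠ 0 := fun h => by simp [h] at hv
  have hr0 : (r : ℂ) ≠ 0 := Complex.ofReal_ne_zero.2 hr.ne'
  -- the real root does not vanish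
  have hrr : |r - r⁻¹| ≠ 0 := by
    rw [abs_ne_zero, sub_ne_zero]
    intro h
    have h2 : r * r = 1 := by
      nth_rewrite 2 [h]
      exact mul_inv_cancel₀ hr.ne'
    rcases mul_self_eq_one_iff.1 h2 with h3 | h3
    · exact hr1 h3
    · linarith
  -- the complex roots do not vanish (`‖r·u‖ = r ≠ 1 = ‖v‖`)
  have hd : (r : ℂ) * u - v ≠ 0 := by
    intro h
    have h1 : ‖(r : ℂ) * u‖ = ‖v‖ := by rw [sub_eq_zero.1 h]
    rw [norm_mul, hu, hv, mul_one, Complex.norm_real, Real.norm_eq_abs, abs_of_pos hr] at h1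
    exact hr1 h1
  have hdn : ‖(r : ℂ) * u - v‖ ≠ 0 := norm_ne_zero_iff.2 hd
  -- `|E₁−E₀|²` as `z·conj z`
  have hsq : ((r : ℂ) * u - v) * conj ((r : ℂ) * u - v) = ((‖(r : ℂ) * u - v‖ ^ 2 : ℝ) : ℂ) := by
    rw [Complex.mul_conj, Complex.normSq_eq_norm_sq]
  rw [boost_root_product_eq hr hu hv, norm_boost_root_two hr hu hv, hsq]
  have hpow : ((r : ℂ) * u * ((r : ℂ)⁻¹ * u)) ^ k = (u * u) ^ k := by
    congr 1; field_simp
  rw [hpow, zpow_add₀ hu0, zpow_mul, zpow_two, zpow_one]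
  -- freeze the two moduli and the unit power, then clear denominators
  generalize hA : |r - r⁻¹| = A at hrr ⊢
  generalize hN : ‖(r : ℂ) * u - v‖ = N at hdn ⊢
  generalize (u * u) ^ k = P
  have hAC : (A : ℂ) ≠ 0 := Complex.ofReal_ne_zero.2 hrr
  have hNC : (N : ℂ) ≠ 0 := Complex.ofReal_ne_zero.2 hdn
  push_cast
  field_simp

end PlaceAlgebra

/-! ## §2 The chart: `R_H · M♭_k = Ũ_k`, an entire unit monomial, on the `H`-regular set -/

section Chart

variable {W : Type*} [Fintype W] [DecidableEq W]

/-- **Split place, chart currency**: `|e^{x}−e^{−x}| · [(τD)_w ∕ R′_w] = e^{i(2k+1)θ}` for the boost triple `boostEig (x, φ, θ)`, `x ≠ 0` (★ `splitPrefactor_resolve` with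
`r = eˣ`, `u = e^{iθ}`, `v = e^{iφ}`). [cite: Rogawski1990, §4.9 p. 55; §8.2 p. 119] [cite: Shelstad1979, §4 p. 22] -/
theorem splitFactor_resolve (cw : Fin 3 → ℝ) (hx : cw 0 ≠ 0) (k : ℤ) :
    ((|Real.exp (cw 0) - Real.exp (-cw 0)| : ℝ) : ℂ) *
        (-((((boostEig cw 0) * (boostEig cw 2)) ^ k) * (((boostEig cw 1) - (boostEig cw 0)) * ((boostEig cw 1) - (boostEig cw 2))) / (boostEig cw 1)) /
          ((|Real.exp (cw 0) - Real.exp (-cw 0)| *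
              ‖Complex.exp (cw 0 + cw 2 * I) - Complex.exp (cw 1 * I)‖ * ‖Complex.exp (-cw 0 + cw 2 * I) - Complex.exp (cw 1 * I)‖ : ℝ) : ℂ)) =
      Complex.exp (((2 * k + 1 : ℤ) : ℂ) * ((cw 2 : ℂ) * I)) := by
  have h0 : boostEig cw 0 = (Real.exp (cw 0) : ℂ) * Complex.exp ((cw 2 : ℂ) * I) := by
    simp only [boostEig, Matrix.cons_val_zero]
    rw [Complex.exp_add, ← Complex.ofReal_exp]
  have h2 : boostEig cw 2 = ((Real.exp (cw 0) : ℂ))⁻¹ * Complex.exp ((cw 2 : ℂ) * I) := by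
    simp only [boostEig, Matrix.cons_val_two, Matrix.tail_cons, Matrix.head_cons]
    rw [Complex.exp_add, ← Complex.ofReal_neg, ← Complex.ofReal_exp, Real.exp_neg, Complex.ofReal_inv]
  have h1 : boostEig cw 1 = Complex.exp ((cw 1 : ℂ) * I) := by
    simp only [boostEig, Matrix.cons_val_one, Matrix.cons_val_zero]
  have hn0 : Complex.exp ((cw 0 : ℂ) + (cw 2 : ℂ) * I) = (Real.exp (cw 0) : ℂ) * Complex.exp ((cw 2 : ℂ) * I) := by
    rw [Complex.exp_add, ← Complex.ofReal_exp]
  have hn2 : Complex.exp (-(cw 0 : ℂ) + (cw 2 : ℂ) * I) = ((Real.exp (cw 0) : ℂ))⁻¹ * Complex.exp ((cw 2 : ℂ) * I) := by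
    rw [Complex.exp_add, ← Complex.ofReal_neg, ← Complex.ofReal_exp, Real.exp_neg, Complex.ofReal_inv]
  rw [h0, h1, h2, hn0, hn2, Real.exp_neg, Complex.exp_int_mul]
  exact splitPrefactor_resolve (Real.exp_pos _) (fun h => hx (Real.exp_eq_one_iff _ |>.1 h)) (Complex.norm_exp_ofReal_mul_I _)
    (Complex.norm_exp_ofReal_mul_I _) k

/-- **`R_H · M♭_k = Ũ_k` ON THE `H`-REGULAR SET**: the product of ★ `archRH S` with ★ A1's prefactor `M♭_k` equals the ENTIRE UNIT MONOMIAL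
`Ũ_k(c) = Π_{w ∈ S} e^{i(2k_w+1)c_{w2}} · Π_{w ∉ S} (E_{w0}E_{w2})^{k_w}·E_{w2}` at every `c ∈ RegS S` (the only points where `M♭_k` is a genuine quotient); `Ũ_k` itself is defined
and smooth everywhere. [cite: Rogawski1990, §4.3 (4.3.1) p. 43; §4.9 p. 55] [cite: Shelstad1979, §4 pp. 22–24] -/
theorem archRH_mul_prefactor_eq_unit (S : Finset W) (k : W → ℤ) {c : W → Fin 3 → ℝ} (hc : c ∈ RegS S) :
    archRH S c * (∏ w : W, (if w ∈ S then
          -((((boostEig (c w) 0) * (boostEig (c w) 2)) ^ (k w)) * (((boostEig (c w) 1) - (boostEig (c w) 0)) * ((boostEig (c w) 1) - (boostEig (c w) 2))) /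
              (boostEig (c w) 1)) /
            ((|Real.exp (c w 0) - Real.exp (-c w 0)| *
                ‖Complex.exp (c w 0 + c w 2 * I) - Complex.exp (c w 1 * I)‖ * ‖Complex.exp (-c w 0 + c w 2 * I) - Complex.exp (c w 1 * I)‖ : ℝ) : ℂ)
        else (((Circle.exp (c w 0) : ℂ) * Circle.exp (c w 2)) ^ (k w)) * ((Circle.exp (c w 0) : ℂ) * Circle.exp (c w 2)) /
          ((Circle.exp (c w 0) : ℂ) - Circle.exp (c w 2)))) =
      ∏ w : W, (if w ∈ S then Complex.exp (((2 * k w + 1 : ℤ) : ℂ) * ((c w 2 : ℂ) * I))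
        else (((Circle.exp (c w 0) : ℂ) * Circle.exp (c w 2)) ^ (k w)) * (Circle.exp (c w 2) : ℂ)) := by
  unfold archRH
  rw [← Finset.prod_mul_distrib]
  refine Finset.prod_congr rfl fun w _ => ?_
  by_cases hw : w ∈ S
  · simp only [if_pos hw]
    exact splitFactor_resolve (c w) (((mem_regS_iff S c).1 hc).2 w hw) (k w)
  · simp only [if_neg hw]
    have h02 : (Circle.exp (c w 0) : ℂ) ≠ Circle.exp (c w 2) := fun h => ((mem_regS_iff S c).1 hc).1 w hw (Subtype.ext h)
    rw [Circle.exp_sub, Circle.coe_div]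
    exact compactPrefactor_resolve (Circle.coe_ne_zero _) h02 (k w)

/-- **`Ũ_k` is entire** (`C^∞` on the whole coordinate space). [cite: Shelstad1979, §4 p. 22] [cite: Rogawski1990, §4.9 p. 55] -/
theorem contDiff_unit (S : Finset W) (k : W → ℤ) :
    ContDiff ℝ ∞ (fun c : W → Fin 3 → ℝ => ∏ w : W, (if w ∈ S then Complex.exp (((2 * k w + 1 : ℤ) : ℂ) * ((c w 2 : ℂ) * I))
        else (((Circle.exp (c w 0) : ℂ) * Circle.exp (c w 2)) ^ (k w)) * (Circle.exp (c w 2) : ℂ))) := by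
  refine contDiff_prod fun w _ => ?_
  by_cases hw : w ∈ S
  · simp only [if_pos hw]
    exact contDiff_cexp_comp (contDiff_const.mul ((contDiff_coe_coord w 2).mul contDiff_const))
  · simp only [if_neg hw]
    exact (contDiff_coe_circleExp_mul_zpow w 0 2 (k w)).mul (contDiff_coe_circleExp_coord w 2)

/-- **`Ũ_k` is a unit**: `‖Ũ_k(c)‖ = 1`. [cite: Shelstad1979, §4 p. 22] -/
theorem norm_unit (S : Finset W) (k : W → ℤ) (c : W → Fin 3 → ℝ) :
    ‖∏ w : W, (if w ∈ S then Complex.exp (((2 * k w + 1 : ℤ) : ℂ) * ((c w 2 : ℂ) * I))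
        else (((Circle.exp (c w 0) : ℂ) * Circle.exp (c w 2)) ^ (k w)) * (Circle.exp (c w 2) : ℂ))‖ = 1 := by
  rw [norm_prod]
  refine Finset.prod_eq_one fun w _ => ?_
  by_cases hw : w ∈ S
  · simp only [if_pos hw]
    rw [Complex.exp_int_mul, norm_zpow, Complex.norm_exp_ofReal_mul_I, one_zpow]
  · simp only [if_neg hw, norm_mul, norm_zpow, Circle.norm_coe, mul_one, one_zpow]

/-- **The twist `archERhoG S ∘ slotPerm ρ` is entire.** [cite: Shelstad1979, §4 p. 24] -/
theorem contDiff_archERhoG_slotPerm (S : Finset W) (ρ : W → Perm (Fin 3)) :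
    ContDiff ℝ ∞ (fun c : W → Fin 3 → ℝ => archERhoG S (slotPerm ρ c)) := by
  unfold archERhoG
  refine contDiff_prod fun w _ => ?_
  by_cases hw : w ∈ S
  · simp only [if_pos hw]
    exact contDiff_const
  · simp only [if_neg hw, slotPerm_apply, Circle.coe_exp]
    exact contDiff_cexp_comp ((Complex.ofRealCLM.contDiff.comp ((contDiff_coord w (ρ w 0)).sub (contDiff_coord w (ρ w 2)))).mul contDiff_const)

omit [Fintype W] [DecidableEq W] in
/-- `slotPerm ρ` is (the underlying map of) a continuous linear automorphism of the coordinate space. [cite: Shelstad1979, Lemma 4.2 (p. 23)] -/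
theorem exists_continuousLinearEquiv_eq_slotPerm [Finite W] (ρ : W → Perm (Fin 3)) :
    ∃ P : (W → Fin 3 → ℝ) ≃L[ℝ] (W → Fin 3 → ℝ), ∀ c, P c = slotPerm ρ c := by
  refine ⟨(LinearEquiv.piCongrRight fun w => LinearEquiv.funCongrLeft ℝ ℝ (ρ w)).toContinuousLinearEquiv, fun c => ?_⟩
  funext w i
  rfl

omit [Fintype W] [DecidableEq W] in
/-- `slotPerm ρ` is continuous. [cite: Shelstad1979, Lemma 4.2 (p. 23)] -/
theorem continuous_slotPerm (ρ : W → Perm (Fin 3)) : Continuous (slotPerm ρ : (W → Fin 3 → ℝ) → W → Fin 3 → ℝ) :=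
  continuous_pi fun w => continuous_pi fun i => (continuous_apply (ρ w i)).comp (continuous_apply w)

/-- **The tame set `V_S = {c | every partner point lies in T_{in-reg}(G′)}` is open.** [cite: Bouaziz1994IntegralesOrbitales, §3.2 p. 579] -/
theorem isOpen_setOf_forall_slotPerm_mem_inRegG (s : W → Fin 3 → SignType) (S : Finset W) :
    IsOpen {c : W → Fin 3 → ℝ | ∀ ρ ∈ partnerPerms S, slotPerm ρ c ∈ InRegG s S} := by
  have h : {c : W → Fin 3 → ℝ | ∀ ρ ∈ partnerPerms S, slotPerm ρ c ∈ InRegG s S} = ⋂ ρ ∈ partnerPerms S, slotPerm ρ ⁻¹' InRegG s S := by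
    ext c; simp only [Set.mem_setOf_eq, Set.mem_iInter, Set.mem_preimage]
  rw [h]
  exact isOpen_biInter_finset fun ρ _ => (isOpen_inRegG s S).preimage (continuous_slotPerm ρ)

/-- A `G`-regular point is tame: its partner points are `G`-regular, hence in `T_{in-reg}(G′)`. [cite: Bouaziz1994IntegralesOrbitales, §3.2 p. 579] -/
theorem forall_slotPerm_mem_inRegG_of_mem_regG (s : W → Fin 3 → SignType) (S : Finset W) {c : W → Fin 3 → ℝ} (hc : c ∈ RegG S) :
    ∀ ρ ∈ partnerPerms S, slotPerm ρ c ∈ InRegG s S :=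
  fun _ hρ => regG_subset_inRegG s S ((slotPerm_mem_regG_iff hρ c).2 hc)

/-- **Tameness criterion**: a point which is `G`-regular at every INDEFINITE compact place is tame — at a definite place (`s w` constant) ★ `InRegG` imposes nothing, and the split
places are never constrained (the real walls `x_w = 0` are allowed). [cite: Bouaziz1994IntegralesOrbitales, §6.2 p. 591] [cite: Shelstad1979, §4 p. 23] -/
theorem forall_slotPerm_mem_inRegG_of_injective (s : W → Fin 3 → SignType) (S : Finset W) {c : W → Fin 3 → ℝ}
    (hreg : ∀ w, w ∉ S → IsIndefiniteAt s w → Function.Injective fun i : Fin 3 => Circle.exp (c w i)) :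
    ∀ ρ ∈ partnerPerms S, slotPerm ρ c ∈ InRegG s S := by
  intro ρ _ w hw i j hij hs
  by_cases hind : IsIndefiniteAt s w
  · intro h
    exact hij ((ρ w).injective (hreg w hw hind h))
  · exfalso
    unfold IsIndefiniteAt at hind
    push Not at hind
    have hall : ∀ l : Fin 3, s w l = s w 0 := by
      intro l
      fin_cases l
      · rfl
      · exact hind.1.symm
      · exact hind.2.symm.trans hind.1.symm
    exact hs ((hall i).trans (hall j).symm)

end Chart

/-! ## §3 The resolved partner sum on the `G`-regular set and its smooth representative `Φ_k` -/

section Resolved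

variable (L : Type) [Field L] [NumberField L] [IsCMField L] (α : Fin 3 → L) (μ : HeckeCharacter L)

/-- **`transfFamReg S c = w_S · Ũ_k(c) · Σ_ρ (K_ρσ_ρ) · archERhoG S(ρ·c) · F S(ρ·c)` ON `RegG S`** (★ A1 `transfFamReg_eq_prefactor_mul_sum` with its prefactor resolved by
`archRH_mul_prefactor_eq_unit`): the `Δ″`-weighted partner sum is a κ-signed combination of the twisted family at the partner points with ENTIRE UNIT coefficients — no
`|eˣ−e⁻ˣ|`, no modulus of a complex root, no Weyl denominator left. [cite: Rogawski1990, §4.3 (4.3.1) p. 43; §4.9 p. 55] [cite: Shelstad1979, §4 pp. 22–24]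
[cite: Bouaziz1994IntegralesOrbitales, Rem. 2 p. 594] -/
theorem transfFamReg_eq_unit_mul_sum {S : Finset {w : InfinitePlace L // IsComplex w}} (hS : ∀ w ∈ S, w ∈ splitChartPlaces L α)
    (F : Finset {w : InfinitePlace L // IsComplex w} → ({w : InfinitePlace L // IsComplex w} → Fin 3 → ℝ) → ℂ) (k : {w : InfinitePlace L // IsComplex w} → ℤ)
    (hk : ∀ c : {w : InfinitePlace L // IsComplex w} → Fin 3 → ℝ,
      archTau L (endoTorus L S c) μ * (archWeylRatio L (endoTorus L S c) : ℂ) =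
        ∏ w : {w : InfinitePlace L // IsComplex w},
          -(((((if w ∈ S then boostEig (c w) else fun i => (Circle.exp (c w i) : ℂ)) 0) * ((if w ∈ S then boostEig (c w) else fun i => (Circle.exp (c w i) : ℂ)) 2)) ^ (k w)) *
              ((((if w ∈ S then boostEig (c w) else fun i => (Circle.exp (c w i) : ℂ)) 1) - ((if w ∈ S then boostEig (c w) else fun i => (Circle.exp (c w i) : ℂ)) 0)) *
                (((if w ∈ S then boostEig (c w) else fun i => (Circle.exp (c w i) : ℂ)) 1) - ((if w ∈ S then boostEig (c w) else fun i => (Circle.exp (c w i) : ℂ)) 2))) /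
            ((if w ∈ S then boostEig (c w) else fun i => (Circle.exp (c w i) : ℂ)) 1)))
    {c : {w : InfinitePlace L // IsComplex w} → Fin 3 → ℝ} (hc : c ∈ RegG S) :
    transfFamReg L α μ F S c =
      (partnerWeight L α S *
        ∏ w : {w : InfinitePlace L // IsComplex w}, (if w ∈ S then Complex.exp (((2 * k w + 1 : ℤ) : ℂ) * ((c w 2 : ℂ) * I))
          else (((Circle.exp (c w 0) : ℂ) * Circle.exp (c w 2)) ^ (k w)) * (Circle.exp (c w 2) : ℂ))) *
      ∑ ρ ∈ partnerPerms S,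
        (((∏ w : {w : InfinitePlace L // IsComplex w},
            ((SignType.sign ((w.1.embedding (α (lineOf (formSign L α w) ((ρ w).symm 1)))).re) : ℤ) * archMajoritySign L (Matrix.diagonal α) w) : ℤ) : ℂ) *
          ∏ w : {w : InfinitePlace L // IsComplex w}, (Equiv.Perm.sign (ρ w) : ℂ)) *
        (archERhoG S (slotPerm ρ c) * F S (slotPerm ρ c)) := by
  rw [transfFamReg_eq_prefactor_mul_sum L α μ hS F k hk hc, mul_right_comm (archRH S c),
    archRH_mul_prefactor_eq_unit S k (regG_subset_regS S hc)]
  congr 1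
  exact mul_comm _ _

omit [IsCMField L] in
/-- **The smooth representative `Φ_k` is `C^∞` on the tame set `V_S`** (`Ũ_k` and the twists `archERhoG S ∘ slotPerm ρ` are entire; `F S ∘ slotPerm ρ` is `C^∞` on
`slotPerm ρ ⁻¹ T_{in-reg}(G′)` by HC's (I₁) clause). [cite: Bouaziz1994IntegralesOrbitales, §3.2 (I₁)–(I₂) p. 579] [cite: Varadarajan1977, Part I §1.12] -/
theorem contDiffOn_resolvedSum (S : Finset {w : InfinitePlace L // IsComplex w})
    (F : Finset {w : InfinitePlace L // IsComplex w} → ({w : InfinitePlace L // IsComplex w} → Fin 3 → ℝ) → ℂ) (k : {w : InfinitePlace L // IsComplex w} → ℤ)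
    (hI1 : ContDiffOn ℝ ∞ (F S) (InRegG (slotSign L α) S)) :
    ContDiffOn ℝ ∞ (fun c : {w : InfinitePlace L // IsComplex w} → Fin 3 → ℝ =>
      (partnerWeight L α S *
        ∏ w : {w : InfinitePlace L // IsComplex w}, (if w ∈ S then Complex.exp (((2 * k w + 1 : ℤ) : ℂ) * ((c w 2 : ℂ) * I))
          else (((Circle.exp (c w 0) : ℂ) * Circle.exp (c w 2)) ^ (k w)) * (Circle.exp (c w 2) : ℂ))) *
      ∑ ρ ∈ partnerPerms S,
        (((∏ w : {w : InfinitePlace L // IsComplex w},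
            ((SignType.sign ((w.1.embedding (α (lineOf (formSign L α w) ((ρ w).symm 1)))).re) : ℤ) * archMajoritySign L (Matrix.diagonal α) w) : ℤ) : ℂ) *
          ∏ w : {w : InfinitePlace L // IsComplex w}, (Equiv.Perm.sign (ρ w) : ℂ)) *
        (archERhoG S (slotPerm ρ c) * F S (slotPerm ρ c)))
      {c | ∀ ρ ∈ partnerPerms S, slotPerm ρ c ∈ InRegG (slotSign L α) S} := by
  refine ((contDiff_const.mul (contDiff_unit S k)).contDiffOn).mul (ContDiffOn.sum fun ρ hρ => ?_)
  refine (contDiff_const.contDiffOn).mul (((contDiff_archERhoG_slotPerm S ρ).contDiffOn).mul ?_)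
  obtain ⟨P, hP⟩ := exists_continuousLinearEquiv_eq_slotPerm ρ
  have hcomp : (fun c : {w : InfinitePlace L // IsComplex w} → Fin 3 → ℝ => F S (slotPerm ρ c)) = F S ∘ P := by
    funext c; rw [Function.comp_apply, hP]
  rw [hcomp]
  exact hI1.comp P.contDiff.contDiffOn fun c hc => by rw [hP]; exact hc ρ hρ

end Resolved

/-! ## §4 `transfFam` is `C^∞` near every tame point of `InRegS S` (real walls, definite-place walls and their corners included) -/

section Tame

variable (L : Type) [Field L] [NumberField L] [IsCMField L] (α : Fin 3 → L) (μ : HeckeCharacter L)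

/-- **`transfFam … S` IS `C^∞` ON A NEIGHBOURHOOD OF EVERY TAME POINT OF `InRegS S`.**  For an admissible chart `S ⊆ splitChartPlaces L α`, under the `μ`-guard, with HC's (I₁)
clause for `F S` (`C^∞` on ★ `InRegG (slotSign L α) S`), at every `p ∈ InRegS S` all of whose partner points `slotPerm ρ p` (`ρ ∈ partnerPerms S`) lie in `InRegG (slotSign L α) S`
the family member `transfFam L α μ F S = bzExtendG S (transfFamReg …)` is `C^∞` on an open neighbourhood: there it coincides with the smooth representative `Φ_k`
(`transfFamReg = Φ_k` on the dense open `RegG S`, ★ `dense_regG`; off `RegG S` the `extendFrom` value is the limit of `Φ_k`).  Covers: `RegG S`; the REAL WALLS `x_w = 0`, `w ∈ S`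
(any number at once, the `H`-central locus included); the `G`-walls at DEFINITE places. [cite: Bouaziz1994IntegralesOrbitales, §3.2 (I₁)–(I₂) p. 579; Rem. 2 p. 594]
[cite: Varadarajan1977, Part I §1.12] [cite: Rogawski1990, §4.3 (4.3.1) p. 43] -/
theorem exists_nhds_contDiffOn_transfFam_of_tame
    (hμω : ∀ x : ideleGroup ↥(maximalRealSubfield L), μ (AdeleRing.ideleBaseChange (↥(maximalRealSubfield L)) L x) = quadraticHeckeCharCM L x)
    {S : Finset {w : InfinitePlace L // IsComplex w}} (hS : ∀ w ∈ S, w ∈ splitChartPlaces L α)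
    {F : Finset {w : InfinitePlace L // IsComplex w} → ({w : InfinitePlace L // IsComplex w} → Fin 3 → ℝ) → ℂ} (hI1 : ContDiffOn ℝ ∞ (F S) (InRegG (slotSign L α) S))
    {p : {w : InfinitePlace L // IsComplex w} → Fin 3 → ℝ} (hp : p ∈ InRegS S) (htame : ∀ ρ ∈ partnerPerms S, slotPerm ρ p ∈ InRegG (slotSign L α) S) :
    ∃ U ∈ 𝓝 p, IsOpen U ∧ ContDiffOn ℝ ∞ (transfFam L α μ F S) U := by
  obtain ⟨k, hk⟩ := exists_archTau_mul_archWeylRatio_endoTorus_eq L μ hμω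
  set V : Set ({w : InfinitePlace L // IsComplex w} → Fin 3 → ℝ) := {c | ∀ ρ ∈ partnerPerms S, slotPerm ρ c ∈ InRegG (slotSign L α) S} with hVdef
  have hV : IsOpen V := isOpen_setOf_forall_slotPerm_mem_inRegG (slotSign L α) S
  have hU : IsOpen (InRegS S ∩ V) := (isOpen_inRegS S).inter hV
  have hpU : p ∈ InRegS S ∩ V := ⟨hp, htame⟩
  have hΦ := contDiffOn_resolvedSum L α S F k hI1
  refine ⟨InRegS S ∩ V, hU.mem_nhds hpU, hU, (hΦ.mono inter_subset_right).congr fun c hc => ?_⟩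
  -- `transfFam = Φ_k` on `InRegS S ∩ V`
  by_cases hcR : c ∈ RegG S
  · rw [transfFam_of_mem_regG L α μ F S hcR]
    exact transfFamReg_eq_unit_mul_sum L α μ hS F k (hk S) hcR
  · rw [transfFam_of_mem_inRegS_of_not_mem_regG L α μ F S hc.1 hcR]
    refine extendFrom_eq (by rw [(dense_regG S).closure_eq]; exact Set.mem_univ c) ?_
    have hcont : ContinuousAt (fun c : {w : InfinitePlace L // IsComplex w} → Fin 3 → ℝ =>
        (partnerWeight L α S *
          ∏ w : {w : InfinitePlace L // IsComplex w}, (if w ∈ S then Complex.exp (((2 * k w + 1 : ℤ) : ℂ) * ((c w 2 : ℂ) * I))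
            else (((Circle.exp (c w 0) : ℂ) * Circle.exp (c w 2)) ^ (k w)) * (Circle.exp (c w 2) : ℂ))) *
        ∑ ρ ∈ partnerPerms S,
          (((∏ w : {w : InfinitePlace L // IsComplex w},
              ((SignType.sign ((w.1.embedding (α (lineOf (formSign L α w) ((ρ w).symm 1)))).re) : ℤ) * archMajoritySign L (Matrix.diagonal α) w) : ℤ) : ℂ) *
            ∏ w : {w : InfinitePlace L // IsComplex w}, (Equiv.Perm.sign (ρ w) : ℂ)) *
          (archERhoG S (slotPerm ρ c) * F S (slotPerm ρ c))) c :=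
      (hΦ.continuousOn c hc.2).continuousAt (hV.mem_nhds hc.2)
    refine (hcont.tendsto.mono_left nhdsWithin_le_nhds).congr' (eventually_of_mem self_mem_nhdsWithin fun y hy => ?_)
    exact (transfFamReg_eq_unit_mul_sum L α μ hS F k (hk S) hy).symm

/-- **Corollary (`RegG` points): `transfFam … S` is `C^∞` on the `G`-regular set `RegG S`.** [cite: Rogawski1990, §4.3 (4.3.1) p. 43] [cite: Bouaziz1994IntegralesOrbitales, §3.2 (I₁) p. 579] -/
theorem contDiffOn_transfFam_regG
    (hμω : ∀ x : ideleGroup ↥(maximalRealSubfield L), μ (AdeleRing.ideleBaseChange (↥(maximalRealSubfield L)) L x) = quadraticHeckeCharCM L x)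
    {S : Finset {w : InfinitePlace L // IsComplex w}} (hS : ∀ w ∈ S, w ∈ splitChartPlaces L α)
    {F : Finset {w : InfinitePlace L // IsComplex w} → ({w : InfinitePlace L // IsComplex w} → Fin 3 → ℝ) → ℂ} (hI1 : ContDiffOn ℝ ∞ (F S) (InRegG (slotSign L α) S)) :
    ContDiffOn ℝ ∞ (transfFam L α μ F S) (RegG S) := by
  refine contDiffOn_of_locally_contDiffOn fun p hp => ?_
  obtain ⟨U, hU, hUo, hUs⟩ := exists_nhds_contDiffOn_transfFam_of_tame L α μ hμω hS hI1 (regS_subset_inRegS S (regG_subset_regS S hp))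
    (forall_slotPerm_mem_inRegG_of_mem_regG (slotSign L α) S hp)
  exact ⟨U, hUo, mem_of_mem_nhds hU, hUs.mono inter_subset_right⟩

/-- **Corollary (REAL WALLS and definite-place walls): at every point of `InRegS S` which is `G`-regular at each indefinite compact place — in particular at every point whose only
walls are real walls `x_w = 0` (`w ∈ S`) — `transfFam … S` is `C^∞` on a neighbourhood** (no jump across a real root: Harish-Chandra). [cite: Varadarajan1977, Part I §1.12]
[cite: Bouaziz1994IntegralesOrbitales, §3.2 (I₂) p. 579] [cite: Shelstad1979, §4 p. 23] -/
theorem exists_nhds_contDiffOn_transfFam_of_injective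
    (hμω : ∀ x : ideleGroup ↥(maximalRealSubfield L), μ (AdeleRing.ideleBaseChange (↥(maximalRealSubfield L)) L x) = quadraticHeckeCharCM L x)
    {S : Finset {w : InfinitePlace L // IsComplex w}} (hS : ∀ w ∈ S, w ∈ splitChartPlaces L α)
    {F : Finset {w : InfinitePlace L // IsComplex w} → ({w : InfinitePlace L // IsComplex w} → Fin 3 → ℝ) → ℂ} (hI1 : ContDiffOn ℝ ∞ (F S) (InRegG (slotSign L α) S))
    {p : {w : InfinitePlace L // IsComplex w} → Fin 3 → ℝ} (hp : p ∈ InRegS S)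
    (hreg : ∀ w, w ∉ S → IsIndefiniteAt (slotSign L α) w → Function.Injective fun i : Fin 3 => Circle.exp (p w i)) :
    ∃ U ∈ 𝓝 p, IsOpen U ∧ ContDiffOn ℝ ∞ (transfFam L α μ F S) U :=
  exists_nhds_contDiffOn_transfFam_of_tame L α μ hμω hS hI1 hp (forall_slotPerm_mem_inRegG_of_injective (slotSign L α) S hreg)

/-- The same with the full HC space ★ `ArchHCSpaceG` as hypothesis (its (I₁) clause is what is used). [cite: Bouaziz1994IntegralesOrbitales, §3.2 (I₁)–(I₂) p. 579] -/
theorem exists_nhds_contDiffOn_transfFam_of_hc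
    (hμω : ∀ x : ideleGroup ↥(maximalRealSubfield L), μ (AdeleRing.ideleBaseChange (↥(maximalRealSubfield L)) L x) = quadraticHeckeCharCM L x)
    {S : Finset {w : InfinitePlace L // IsComplex w}} (hS : ∀ w ∈ S, w ∈ splitChartPlaces L α)
    {jc' : Finset {w : InfinitePlace L // IsComplex w} → {w : InfinitePlace L // IsComplex w} → Fin 3 → Fin 3 → ℂ}
    {F : Finset {w : InfinitePlace L // IsComplex w} → ({w : InfinitePlace L // IsComplex w} → Fin 3 → ℝ) → ℂ} (hF : ArchHCSpaceG (slotSign L α) jc' F)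
    {p : {w : InfinitePlace L // IsComplex w} → Fin 3 → ℝ} (hp : p ∈ InRegS S) (htame : ∀ ρ ∈ partnerPerms S, slotPerm ρ p ∈ InRegG (slotSign L α) S) :
    ∃ U ∈ 𝓝 p, IsOpen U ∧ ContDiffOn ℝ ∞ (transfFam L α μ F S) U :=
  exists_nhds_contDiffOn_transfFam_of_tame L α μ hμω hS (hF.2.2.1 S).1 hp htame

end Tame

end Literature.NumberTheory.Rogawski1990

end
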